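import Mathlib
import Literature.AlgebraicGeometry.Resolution.FormalInverseFunction
import Summits.ResolutionOfSingularities.ResolutionOfSingularities.Theorems.WeightedInvariantLocalWeightedDropSpaceCountGame
import Summits.ResolutionOfSingularities.ResolutionOfSingularities.Theorems.WeightedInvariantLocalWeightedDropCoeffTransportPoint

/-!
# `LocalWeightedDrop`, line `nc-game-transport`: **ORDER GROWTH ALONG ONE ROUND OF THE COUNT GAME** — the order of a new
# position is at most twice the order of the old one (plus one for the exceptional letter)

[OURS · L1 W4.3 · chain w43, engine crux `LocalWeightedDrop` stmt-ResolutionOfSingularities-8899; the analytic brick (O)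
«ORDER GROWTH» of res-L1-w43-strat-1's tame relative-binomial (Jung) rung R7 / the (K-c) suspension cut of the N = 4 tame
census (res-L1-w43-stub-1), where it feeds the UNIFORM round bound of the phase-1 transport: the end-game budget is a function
of the exponent box, and this lemma bounds the box along a play.  Folklore bookkeeping on formal power series; NOT a statement
of any manuscript; closes nothing by name.]

A move of the count game (`TameFourTupleDrop.IsCountMove`) is a legal coordinate change `Φ` (no constant terms, invertible
linear part) followed by the cobordant chart `x_l ↦ s^{w_l}(c_l + y_l)` (`CobordantChart.chart w c`, weights `w_l ≤ 1`,
`c_l = 0` on the weight-`0` slots) at an exceptional point `c`, and the slice `y_{i₀} ↦ 0` at a LIVE slot (`c_{i₀} ≠ 0`,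
`TupleGame.slice i₀`); the new position is `s · G|_{y_{i₀} = 0}` for the `s`-saturation `s^A · G` of the transform.  The order
of a position is NOT monotone along a round (free centres need not be equimultiple: `x₀x₂⁵ + x₁³` at the point `(1, 0)` of the
blow-up of the `x₂`-axis has sliced strict transform `y₂⁵ + s²y₁³` of order `5 > 3`), but it grows at most linearly:

* `order_subst_eq_of_isUnit_det` — a legal coordinate change PRESERVES the order (formal inverse function theorem
  `FormalCoordChange.exists_comp_inverse` + `MvPowerSeries.le_order_subst` twice; any number of variables).
* `order_slice_subst_chart_le` — THE GROWTH LEMMA: for `F ≠ 0`, weights `w ≤ 1` with the chart convention and a live slot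
  `i₀`, `ord (F ∘ chart_{w,c})|_{y_{i₀} = 0} ≤ 2 · ord F`.  Proof (the extremal support point, immune to the characteristic):
  among the exponents `d` of `F` of degree `r = ord F` take `d⋆` with `d⋆_{i₀}` minimal; by the coefficient formula
  `CobordantChart.coeff_subst_chart` the coefficient of `s^{w·d⋆} · y^{d⋆ off i₀}` in the sliced transform is the SINGLE term
  `F_{d⋆} · c_{i₀}^{d⋆_{i₀}} ≠ 0` (another exponent `d` of `F` contributing there has `w·d = w·d⋆`, `d ≥ d⋆` off `i₀`, `d = d⋆` on
  the weight-`0` slots, hence — weights being `0` or `1` — degree `r`, so `d_{i₀} ≥ d⋆_{i₀}` by minimality and `d = d⋆`), and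
  its degree is `w·d⋆ + r − d⋆_{i₀} ≤ 2r`.  No hypothesis `s ∤ G` is needed.
* `order_slice_add_le_of_factor` — factored form: `F ∘ chart = s^A · G` ⇒ `ord (G|) + A ≤ 2 · ord F`;
  `order_newPosition_add_le` — position form along a move: `ord (s · G|) + A ≤ 2 · ord b + 1` for `F = b ∘ Φ`, `Φ` legal;
  `order_newPosition_le` — the bare bound `ord (s · G|) ≤ 2 · ord b + 1`, and its `ℕ`-valued reading
  `natOrder_newPosition_add_le`.
-/

set_option linter.dupNamespace false -- mandated namespace of this single-conjunct summit

namespace Summit.ResolutionOfSingularities.ResolutionOfSingularities.Theorems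

namespace NCTransport

open MvPowerSeries Literature.AlgebraicGeometry.Resolution TameFourTupleDrop

variable {k : Type} [Field k]

/-! ## Legal coordinate changes preserve the order -/

/-- A constant-free substitution does not lower the order (`MvPowerSeries.le_order_subst`). -/
theorem order_le_order_subst_of_constantCoeff {n : ℕ} {τ : Type} {θ : Fin n → MvPowerSeries τ k}
    (hθ0 : ∀ i, constantCoeff (θ i) = 0) (g : MvPowerSeries (Fin n) k) : g.order ≤ (subst θ g).order := by
  have h1 : (1 : ℕ∞) ≤ ⨅ i, (θ i).order := le_iInf fun i => one_le_order_iff_constCoeff_eq_zero.mpr (hθ0 i)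
  calc g.order = 1 * g.order := (one_mul _).symm
    _ ≤ (⨅ i, (θ i).order) * g.order := mul_le_mul' h1 le_rfl
    _ ≤ _ := le_order_subst (hasSubst_of_constantCoeff_zero hθ0) g

/-- A LEGAL COORDINATE CHANGE PRESERVES THE ORDER (OURS · L1 W4.3, brick (O1)): for `Φ` with zero constant terms and invertible
linear part, `ord (f ∘ Φ) = ord f` — the inverse substitution of `FormalCoordChange.exists_comp_inverse` and
`MvPowerSeries.le_order_subst` in both directions. -/
theorem order_subst_eq_of_isUnit_det {n : ℕ} {Φ : Fin n → MvPowerSeries (Fin n) k} (hΦ0 : ∀ i, constantCoeff (Φ i) = 0)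
    (hdet : IsUnit (Matrix.det (Matrix.of fun i j => coeff (Finsupp.single j 1) (Φ i)))) (f : MvPowerSeries (Fin n) k) :
    (subst Φ f).order = f.order := by
  obtain ⟨ψ, hψ0, hψΦ, -⟩ := FormalCoordChange.exists_comp_inverse hΦ0 hdet
  have hΦs : HasSubst Φ := hasSubst_of_constantCoeff_zero hΦ0
  have hψs : HasSubst ψ := hasSubst_of_constantCoeff_zero hψ0
  have hback : subst ψ (subst Φ f) = f := by
    rw [subst_comp_subst_apply hΦs hψs]
    have hX : (fun s => subst ψ (Φ s)) = (X : Fin n → MvPowerSeries (Fin n) k) := funext hψΦ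
    rw [hX]
    exact congrFun subst_self f
  refine le_antisymm ?_ (order_le_order_subst_of_constantCoeff hΦ0 f)
  calc (subst Φ f).order ≤ (subst ψ (subst Φ f)).order := order_le_order_subst_of_constantCoeff hψ0 _
    _ = f.order := by rw [hback]

/-! ## Exponent bookkeeping -/

/-- The degree of `(b, τ)` is `b + |τ|`. -/
theorem degree_cons_eq {n : ℕ} (b : ℕ) (τ : Fin n →₀ ℕ) : Finsupp.degree (Finsupp.cons b τ) = b + Finsupp.degree τ := by
  rw [Finsupp.degree_eq_sum, Finsupp.degree_eq_sum, Fin.sum_univ_succ, Finsupp.cons_zero]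
  simp only [Finsupp.cons_succ]

/-- For weights `w_l ≤ 1` the degree splits as the `w`-weight plus the entries on the weight-`0` slots. -/
theorem degree_eq_weight_add_sum_filter {n : ℕ} {w : Fin n → ℕ} (hw : ∀ l, w l ≤ 1) (d : Fin n →₀ ℕ) :
    Finsupp.degree d = Finsupp.weight w d + ∑ l ∈ Finset.univ.filter (fun l => w l = 0), d l := by
  classical
  rw [Finsupp.degree_eq_sum, Finsupp.weight_apply, Finsupp.sum_fintype _ _ (fun _ => by simp), Finset.sum_filter,
    ← Finset.sum_add_distrib]
  refine Finset.sum_congr rfl fun l _ => ?_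
  rcases Nat.le_one_iff_eq_zero_or_eq_one.mp (hw l) with h | h
  · simp [h]
  · simp [h]

/-- For weights `w_l ≤ 1` the `w`-weight is at most the degree. -/
theorem weight_le_degree_of_le_one {n : ℕ} {w : Fin n → ℕ} (hw : ∀ l, w l ≤ 1) (d : Fin n →₀ ℕ) :
    Finsupp.weight w d ≤ Finsupp.degree d := by
  rw [degree_eq_weight_add_sum_filter hw]
  exact Nat.le_add_right _ _

/-! ## The growth lemma -/

/-- THE KEY COEFFICIENT (OURS · L1 W4.3, brick (O2), computational core).  For `F ≠ 0` of order `r`, weights `w ≤ 1` with the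
chart convention and a live slot `i₀` (`c_{i₀} ≠ 0`): there is a degree-`r` exponent `d⋆` of `F` such that the coefficient of
`s^{w·d⋆} · y^{d⋆ off i₀}` in `(F ∘ chart_{w,c})|_{y_{i₀} = 0}` is `F_{d⋆} · c_{i₀}^{d⋆_{i₀}}` (in particular non-zero). -/
theorem exists_coeff_slice_subst_chart_eq {n : ℕ} (w : Fin (n + 1) → ℕ) (c : Fin (n + 1) → k)
    (hc : ∀ l, w l = 0 → c l = 0) (hw : ∀ l, w l ≤ 1) {i₀ : Fin (n + 1)} (hci : c i₀ ≠ 0)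
    {F : MvPowerSeries (Fin (n + 1)) k} (hF : F ≠ 0) :
    ∃ (dstar : Fin (n + 1) →₀ ℕ) (τ : Fin n →₀ ℕ), coeff dstar F ≠ 0 ∧ ((Finsupp.degree dstar : ℕ) : ℕ∞) = F.order ∧
      Finsupp.degree τ + dstar i₀ = Finsupp.degree dstar ∧
      coeff (Finsupp.cons (Finsupp.weight w dstar) τ) (TupleGame.slice i₀ (subst (CobordantChart.chart w c) F)) =
        coeff dstar F * c i₀ ^ dstar i₀ := by
  classical
  have hνF : (F.order.toNat : ℕ∞) = F.order := ne_zero_iff_order_finite.mp hF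
  obtain ⟨d₀, hd₀, hdeg₀⟩ := exists_coeff_ne_zero_and_order hνF
  set r : ℕ := F.order.toNat with hrdef
  -- the degree-`r` exponents in the support of `F`
  let S : Set (Fin (n + 1) →₀ ℕ) := {d | coeff d F ≠ 0 ∧ Finsupp.degree d = r}
  have hSfin : S.Finite := (Finsupp.finite_of_degree_le r).subset fun d hd => le_of_eq hd.2
  have hSne : S.Nonempty := by
    refine ⟨d₀, hd₀, ?_⟩
    have h : ((Finsupp.degree d₀ : ℕ) : ℕ∞) = (r : ℕ∞) := by rw [hνF]; exact hdeg₀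
    exact_mod_cast h
  -- `d⋆`: minimal `i₀`-entry among them
  obtain ⟨dstar, hdstarS, hmin⟩ := hSfin.exists_minimalFor (fun d => d i₀) S hSne
  obtain ⟨hdstarF, hdstardeg⟩ := hdstarS
  -- `τ` := `d⋆` off `i₀`
  let τ : Fin n →₀ ℕ := Finsupp.equivFunOnFinite.symm fun j => dstar (i₀.succAbove j)
  have hτ : ∀ l, l ≠ i₀ → Finsupp.mapDomain i₀.succAbove τ l = dstar l := fun l hl =>
    CoeffTransport.mapDomain_succAbove_comap i₀ dstar l hl
  have hτ0 : Finsupp.mapDomain i₀.succAbove τ i₀ = 0 := CoeffTransport.mapDomain_succAbove_apply_self i₀ τ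
  refine ⟨dstar, τ, hdstarF, by rw [hdstardeg, hνF], ?_, ?_⟩
  · -- `|τ| + d⋆ i₀ = |d⋆|`
    have h1 : Finsupp.degree (Finsupp.mapDomain i₀.succAbove τ) + dstar i₀ = Finsupp.degree dstar := by
      rw [Finsupp.degree_eq_sum, Finsupp.degree_eq_sum, ← Finset.add_sum_erase _ _ (Finset.mem_univ i₀),
        ← Finset.add_sum_erase _ (fun l => dstar l) (Finset.mem_univ i₀), hτ0, zero_add, add_comm]
      congr 1
      exact Finset.sum_congr rfl fun l hl => hτ l (Finset.ne_of_mem_erase hl)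
    rwa [Finsupp.degree_mapDomain] at h1
  · unfold TupleGame.slice
    rw [CobordantChartPlaneSlice.coeff_subst_slice, CoeffTransport.mapDomain_succ_succAbove_cons,
      CobordantChart.coeff_subst_chart w c hc, finsum_eq_single _ dstar]
    · rw [if_pos rfl, Finset.prod_eq_single i₀]
      · rw [hτ0, Nat.choose_zero_right, Nat.cast_one, one_mul, Nat.sub_zero]
      · intro l _ hl
        rw [hτ l hl, Nat.choose_self, Nat.cast_one, one_mul, Nat.sub_self, pow_zero]
      · intro h; exact absurd (Finset.mem_univ i₀) h
    · intro d hd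
      split_ifs with hwt
      · by_cases hdF : coeff d F = 0
        · rw [hdF, zero_mul]
        · -- unless some binomial factor dies, `d = d⋆`
          suffices h : ∃ l, (((d l).choose (Finsupp.mapDomain i₀.succAbove τ l) : k) *
              c l ^ (d l - Finsupp.mapDomain i₀.succAbove τ l)) = 0 by
            obtain ⟨l, hl⟩ := h
            rw [Finset.prod_eq_zero (Finset.mem_univ l) hl, mul_zero]
          by_contra hall
          push Not at hall
          -- (a) `d ≥ d⋆` off `i₀`
          have hge : ∀ l, l ≠ i₀ → dstar l ≤ d l := by
            intro l hl
            rw [← hτ l hl]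
            by_contra hlt
            push Not at hlt
            exact hall l (by rw [Nat.choose_eq_zero_of_lt hlt, Nat.cast_zero, zero_mul])
          -- (b) `d = d⋆` on the slots with `c_l = 0`, in particular on the weight-`0` slots
          have heq0 : ∀ l, c l = 0 → d l = dstar l := by
            intro l hcl
            have hl : l ≠ i₀ := by rintro rfl; exact hci hcl
            refine le_antisymm ?_ (hge l hl)
            rw [← hτ l hl]
            by_contra hlt
            push Not at hlt
            exact hall l (by rw [hcl, zero_pow (Nat.sub_ne_zero_of_lt hlt), mul_zero])
          -- (c) hence `|d| = r`
          have hdegd : Finsupp.degree d = r := by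
            rw [← hdstardeg, degree_eq_weight_add_sum_filter hw d, degree_eq_weight_add_sum_filter hw dstar, hwt]
            congr 1
            exact Finset.sum_congr rfl fun l hl => heq0 l (hc l (Finset.mem_filter.mp hl).2)
          -- (d) minimality: `d⋆ i₀ ≤ d i₀`, so `d ≥ d⋆` everywhere; equal degrees force `d = d⋆`
          have hdS : d ∈ S := ⟨hdF, hdegd⟩
          have hi₀ : dstar i₀ ≤ d i₀ := by
            by_contra hlt
            push Not at hlt
            exact absurd (hmin hdS hlt.le) (not_le.mpr hlt)
          have hall' : ∀ l, dstar l ≤ d l := fun l => by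
            by_cases hl : l = i₀
            · rw [hl]; exact hi₀
            · exact hge l hl
          apply hd
          have hsum : ∑ l, dstar l = ∑ l, d l := by
            rw [← Finsupp.degree_eq_sum, ← Finsupp.degree_eq_sum, hdstardeg, hdegd]
          ext l
          exact ((Finset.sum_eq_sum_iff_of_le fun l _ => hall' l).mp hsum l (Finset.mem_univ l)).symm
      · rfl

/-- **ORDER GROWTH UNDER A SLICED CHART** (OURS · L1 W4.3, brick (O2)).  For weights `w_l ≤ 1` with the chart convention
`w_l = 0 → c_l = 0` and a live slot `i₀` (`c_{i₀} ≠ 0`): `ord (F ∘ chart_{w,c})|_{y_{i₀} = 0} ≤ 2 · ord F`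
(for `F = 0` both sides are `⊤`). -/
theorem order_slice_subst_chart_le {n : ℕ} (w : Fin (n + 1) → ℕ) (c : Fin (n + 1) → k) (hc : ∀ l, w l = 0 → c l = 0)
    (hw : ∀ l, w l ≤ 1) {i₀ : Fin (n + 1)} (hci : c i₀ ≠ 0) (F : MvPowerSeries (Fin (n + 1)) k) :
    (TupleGame.slice i₀ (subst (CobordantChart.chart w c) F)).order ≤ 2 * F.order := by
  by_cases hF : F = 0
  · rw [hF, order_zero]
    simp
  obtain ⟨dstar, τ, hdstarF, hdeg, hτ, hcoeff⟩ := exists_coeff_slice_subst_chart_eq w c hc hw hci hF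
  have hne : coeff (Finsupp.cons (Finsupp.weight w dstar) τ)
      (TupleGame.slice i₀ (subst (CobordantChart.chart w c) F)) ≠ 0 := by
    rw [hcoeff]
    exact mul_ne_zero hdstarF (pow_ne_zero _ hci)
  have hb : Finsupp.weight w dstar ≤ Finsupp.degree dstar := weight_le_degree_of_le_one hw dstar
  have hτle : Finsupp.degree τ ≤ Finsupp.degree dstar := by rw [← hτ]; exact Nat.le_add_right _ _
  calc (TupleGame.slice i₀ (subst (CobordantChart.chart w c) F)).order
        ≤ Finsupp.degree (Finsupp.cons (Finsupp.weight w dstar) τ) := order_le hne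
    _ = ((Finsupp.weight w dstar + Finsupp.degree τ : ℕ) : ℕ∞) := by rw [degree_cons_eq]
    _ ≤ ((2 * Finsupp.degree dstar : ℕ) : ℕ∞) := by exact_mod_cast (by omega)
    _ = 2 * F.order := by rw [Nat.cast_mul, hdeg]; rfl

/-! ## Factored and position forms -/

/-- The order of `s^A`. -/
theorem order_X_zero_pow {n : ℕ} (A : ℕ) : ((X 0 : MvPowerSeries (Fin (n + 1)) k) ^ A).order = A := by
  rw [X_pow_eq, order_monomial_of_ne_zero one_ne_zero, Finsupp.degree_single]

/-- The tuple-game slice fixes powers of `s` (the one-line computation of `MultiplicityLift.slice_X_zero_pow_mul`, restated in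
this namespace for the line's files). -/
theorem slice_X_zero_pow_mul' {m : ℕ} (i : Fin (m + 1)) (A : ℕ) (H : MvPowerSeries (Fin (m + 1 + 1)) k) :
    TupleGame.slice i (X 0 ^ A * H) = X 0 ^ A * TupleGame.slice i H :=
  MultiplicityLift.slice_X_zero_pow_mul i A H

/-- **ORDER GROWTH, FACTORED FORM** (OURS · L1 W4.3, brick (O3)): if `F ∘ chart_{w,c} = s^A · G` (ANY such expression — `s ∤ G`
is not needed), then at a live slot `ord (G|_{y_{i₀} = 0}) + A ≤ 2 · ord F`. -/
theorem order_slice_add_le_of_factor {n : ℕ} {w : Fin (n + 1) → ℕ} {c : Fin (n + 1) → k} (hc : ∀ l, w l = 0 → c l = 0)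
    (hw : ∀ l, w l ≤ 1) {i₀ : Fin (n + 1)} (hci : c i₀ ≠ 0) {F : MvPowerSeries (Fin (n + 1)) k} {A : ℕ}
    {G : MvPowerSeries (Fin (n + 1 + 1)) k} (hfac : subst (CobordantChart.chart w c) F = X 0 ^ A * G) :
    (TupleGame.slice i₀ G).order + A ≤ 2 * F.order := by
  have h := order_slice_subst_chart_le w c hc hw hci F
  rw [hfac, slice_X_zero_pow_mul'] at h
  calc (TupleGame.slice i₀ G).order + A
        = ((X 0 : MvPowerSeries (Fin (n + 1)) k) ^ A).order + (TupleGame.slice i₀ G).order := by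
          rw [order_X_zero_pow, add_comm]
    _ ≤ (X 0 ^ A * TupleGame.slice i₀ G).order := le_order_mul
    _ ≤ 2 * F.order := h

/-- **ORDER GROWTH ALONG ONE ROUND OF THE COUNT GAME** (OURS · L1 W4.3, brick (O3), position form).  For a legal coordinate
change `Φ`, weights `w ≤ 1` with the chart convention, an exceptional point with live slot `i₀`, and any expression
`(b ∘ Φ) ∘ chart_{w,c} = s^A · G`: the new position `s · G|_{y_{i₀} = 0}` satisfies `ord (s · G|) + A ≤ 2 · ord b + 1`. -/
theorem order_newPosition_add_le {m : ℕ} {Φ : Fin (m + 1) → MvPowerSeries (Fin (m + 1)) k}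
    (hΦ0 : ∀ i, constantCoeff (Φ i) = 0) (hdet : IsUnit (Matrix.det (Matrix.of fun i j => coeff (Finsupp.single j 1) (Φ i))))
    {w : Fin (m + 1) → ℕ} {c : Fin (m + 1) → k} (hc : ∀ l, w l = 0 → c l = 0) (hw : ∀ l, w l ≤ 1) {i₀ : Fin (m + 1)}
    (hci : c i₀ ≠ 0) (b : MvPowerSeries (Fin (m + 1)) k) {A : ℕ} {G : MvPowerSeries (Fin (m + 1 + 1)) k}
    (hfac : subst (CobordantChart.chart w c) (subst Φ b) = X 0 ^ A * G) :
    (X 0 * TupleGame.slice i₀ G).order + A ≤ 2 * b.order + 1 := by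
  have h := order_slice_add_le_of_factor hc hw hci hfac
  rw [order_subst_eq_of_isUnit_det hΦ0 hdet] at h
  have hX : ((X 0 : MvPowerSeries (Fin (m + 1)) k)).order = 1 := by
    rw [← pow_one (X 0 : MvPowerSeries (Fin (m + 1)) k), order_X_zero_pow, Nat.cast_one]
  rw [order_mul, hX]
  calc 1 + (TupleGame.slice i₀ G).order + ↑A = ((TupleGame.slice i₀ G).order + ↑A) + 1 := by ring
    _ ≤ 2 * b.order + 1 := by gcongr

/-- The bare bound: the order of a new position is at most `2 · ord b + 1`. -/
theorem order_newPosition_le {m : ℕ} {Φ : Fin (m + 1) → MvPowerSeries (Fin (m + 1)) k}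
    (hΦ0 : ∀ i, constantCoeff (Φ i) = 0) (hdet : IsUnit (Matrix.det (Matrix.of fun i j => coeff (Finsupp.single j 1) (Φ i))))
    {w : Fin (m + 1) → ℕ} {c : Fin (m + 1) → k} (hc : ∀ l, w l = 0 → c l = 0) (hw : ∀ l, w l ≤ 1) {i₀ : Fin (m + 1)}
    (hci : c i₀ ≠ 0) (b : MvPowerSeries (Fin (m + 1)) k) {A : ℕ} {G : MvPowerSeries (Fin (m + 1 + 1)) k}
    (hfac : subst (CobordantChart.chart w c) (subst Φ b) = X 0 ^ A * G) :
    (X 0 * TupleGame.slice i₀ G).order ≤ 2 * b.order + 1 :=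
  le_trans le_self_add (order_newPosition_add_le hΦ0 hdet hc hw hci b hfac)

/-- Along a count-game MOVE (`IsCountMove Φ w`): the same bound, hypotheses read off the move. -/
theorem order_newPosition_add_le_of_isCountMove {m : ℕ} {Φ : Fin (m + 1) → MvPowerSeries (Fin (m + 1)) k}
    {w : Fin (m + 1) → ℕ} (hmv : IsCountMove Φ w) {c : Fin (m + 1) → k} (hc : ∀ l, w l = 0 → c l = 0) {i₀ : Fin (m + 1)}
    (hci : c i₀ ≠ 0) (b : MvPowerSeries (Fin (m + 1)) k) {A : ℕ} {G : MvPowerSeries (Fin (m + 1 + 1)) k}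
    (hfac : subst (CobordantChart.chart w c) (subst Φ b) = X 0 ^ A * G) :
    (X 0 * TupleGame.slice i₀ G).order + A ≤ 2 * b.order + 1 :=
  order_newPosition_add_le hmv.1 hmv.2.1 hc hmv.2.2.1 hci b hfac

/-- `ℕ`-valued reading for non-zero positions: with `ord` the natural-number order (`order.toNat`) and `b ≠ 0`,
`ord (s · G|) + A ≤ 2 · ord b + 1` (the new position is then non-zero as well, so both orders are finite). -/
theorem natOrder_newPosition_add_le {m : ℕ} {Φ : Fin (m + 1) → MvPowerSeries (Fin (m + 1)) k} {w : Fin (m + 1) → ℕ}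
    (hmv : IsCountMove Φ w) {c : Fin (m + 1) → k} (hc : ∀ l, w l = 0 → c l = 0) {i₀ : Fin (m + 1)} (hci : c i₀ ≠ 0)
    {b : MvPowerSeries (Fin (m + 1)) k} (hb : b ≠ 0) {A : ℕ} {G : MvPowerSeries (Fin (m + 1 + 1)) k}
    (hfac : subst (CobordantChart.chart w c) (subst Φ b) = X 0 ^ A * G) :
    (X 0 * TupleGame.slice i₀ G).order.toNat + A ≤ 2 * b.order.toNat + 1 := by
  have h := order_newPosition_add_le_of_isCountMove hmv hc hci b hfac
  have hbfin : (b.order.toNat : ℕ∞) = b.order := ne_zero_iff_order_finite.mp hb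
  rw [← hbfin] at h
  have hlt : (X 0 * TupleGame.slice i₀ G).order < ⊤ := by
    refine lt_of_le_of_lt (le_self_add.trans h) ?_
    exact_mod_cast WithTop.coe_lt_top (2 * b.order.toNat + 1)
  have hfin : ((X 0 * TupleGame.slice i₀ G).order.toNat : ℕ∞) = (X 0 * TupleGame.slice i₀ G).order :=
    ENat.coe_toNat hlt.ne
  rw [← hfin] at h
  exact_mod_cast h

end NCTransport

end Summit.ResolutionOfSingularities.ResolutionOfSingularities.Theorems
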